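import Literature.AlgebraicGeometry.Resolution.WeightedCentreGradedAutomorphism
import Mathlib.Algebra.MvPolynomial.PDeriv
import HarnessLib

/-!
# A kernel vector of `M(0)` becomes a missing partial derivative after a linear block change

Uniform value line: typed theorems in the polynomial weighted-centre model `W(f)` — NOT a
resolution theorem, NOT summit progress; AI review is weaker than expert review.

The block step exits when `V = ker M(0) ≠ 0`, i.e. when a nonzero constant vector `v` has
`Σ_k v_k ∂ₖ F = 0` for the top block layer `F`.  The derivative criterion
(`∂ₖ F = 0 ⇒` every `k`-exponent is divisible by `p`) is stated for a COORDINATE direction; this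
file supplies the linear change of block coordinates turning the direction `v` into a coordinate:
* `lineSubst k₀ v` — the substitution `X_j ↦ X_j + v_j X_{k₀}` (`j ≠ k₀`), `X_{k₀} ↦ v_{k₀} X_{k₀}`
  (the linear map sending `e_{k₀}` to `v`);
* `pderiv_lineSubst` — the chain rule `∂_{k₀} (F ∘ A) = (Σ_k v_k ∂ₖ F) ∘ A` (derived here), so a
  kernel vector gives `∂_{k₀} (F ∘ A) = 0` (`pderiv_lineSubst_eq_zero`);
* `lineSubst_comp_lineSubstInv` / `lineSubstInv_comp_lineSubst` — for `v_{k₀} ≠ 0` the substitution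
  is an automorphism with the explicit inverse `lineSubstInv` (derived here);
* `isWeightedHomogeneous_lineSubst` — it preserves weighted homogeneity when `v` is supported on
  variables of the same weight as `k₀` (one block) (derived here).

[cite: Hironaka1970AdditiveGroups, additive forms and differential operators]
[cite: AbramovichTemkinWlodarczyk2024, §5.2 (pp. 1576–1577): coordinate changes preserving the centre]
-/

open MvPolynomial Finsupp

namespace Literature.AlgebraicGeometry.Resolution.WeightedBlowup

variable {K : Type*} [Field K] {σ : Type*} [DecidableEq σ]

/-- The generator images of the linear substitution sending `e_{k₀}` to `v`:
`X_{k₀} ↦ v_{k₀} X_{k₀}`, `X_j ↦ X_j + v_j X_{k₀}` (`j ≠ k₀`).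
[cite: Hironaka1970AdditiveGroups, additive forms and differential operators] -/
noncomputable def lineGen (k₀ : σ) (v : σ → K) (j : σ) : MvPolynomial σ K :=
  if j = k₀ then C (v k₀) * X k₀ else X j + C (v j) * X k₀

/-- The linear block substitution `F ↦ F ∘ A`, `A e_{k₀} = v`, `A e_j = e_j` (`j ≠ k₀`).
[cite: Hironaka1970AdditiveGroups, additive forms and differential operators] -/
noncomputable def lineSubst (k₀ : σ) (v : σ → K) : MvPolynomial σ K →ₐ[K] MvPolynomial σ K :=
  aeval (lineGen k₀ v)

omit [DecidableEq σ] in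
/-- [folklore] unfolding on a generator. -/
private theorem lineSubst_X [DecidableEq σ] (k₀ : σ) (v : σ → K) (j : σ) :
    lineSubst k₀ v (X j) = lineGen k₀ v j := by
  rw [lineSubst, aeval_X]

/-- The partial derivative `∂_{k₀}` of every generator image is the constant `v_j` (derived here).
[cite: Hironaka1970AdditiveGroups, additive forms and differential operators] -/
theorem pderiv_lineGen (k₀ : σ) (v : σ → K) (j : σ) :
    pderiv k₀ (lineGen k₀ v j) = C (v j) := by
  unfold lineGen
  split_ifs with h
  · subst h
    rw [pderiv_C_mul, pderiv_X_self, mul_one]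
  · rw [map_add, pderiv_C_mul, pderiv_X_self, mul_one, pderiv_X_of_ne h, zero_add]

/-- **Chain rule for the line substitution.**  For `v` supported on the finite set `B`,
`∂_{k₀} (lineSubst k₀ v F) = lineSubst k₀ v (Σ_{k ∈ B} v_k • ∂ₖ F)` (derived here).
[cite: Hironaka1970AdditiveGroups, additive forms and differential operators] -/
theorem pderiv_lineSubst (k₀ : σ) {v : σ → K} (B : Finset σ) (hv : ∀ k ∉ B, v k = 0)
    (F : MvPolynomial σ K) :
    pderiv k₀ (lineSubst k₀ v F) = lineSubst k₀ v (∑ k ∈ B, v k • pderiv k F) := by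
  induction F using MvPolynomial.induction_on with
  | C a =>
    simp only [pderiv_C, smul_zero, Finset.sum_const_zero, map_zero, algHom_C,
      MvPolynomial.algebraMap_eq]
  | add p q hp hq =>
    simp only [map_add, smul_add, Finset.sum_add_distrib, hp, hq]
  | mul_X p j hp =>
    have hsum : (∑ k ∈ B, v k • pderiv k (p * X j)) =
        (∑ k ∈ B, v k • pderiv k p) * X j + p * C (v j) := by
      have h1 : ∀ k ∈ B, v k • pderiv k (p * X j) =
          (v k • pderiv k p) * X j + p * (if k = j then C (v j) else 0) := by
        intro k _
        rw [pderiv_mul, smul_add, smul_mul_assoc]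
        congr 1
        by_cases hkj : k = j
        · subst hkj
          rw [if_pos rfl, pderiv_X_self, mul_one, smul_eq_C_mul, mul_comm]
        · rw [if_neg hkj, pderiv_X_of_ne (Ne.symm hkj), mul_zero, smul_zero]
      rw [Finset.sum_congr rfl h1, Finset.sum_add_distrib, Finset.sum_mul, ← Finset.mul_sum]
      congr 1
      by_cases hj : j ∈ B
      · simp [hj]
      · simp [hv j hj]
    rw [map_mul, lineSubst_X, pderiv_mul, hp, pderiv_lineGen, hsum, map_add, map_mul, map_mul,
      lineSubst_X, algHom_C, MvPolynomial.algebraMap_eq]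

/-- A kernel vector of `M(0)` becomes a vanishing partial derivative: if
`Σ_{k ∈ B} v_k ∂ₖ F = 0` then `∂_{k₀} (lineSubst k₀ v F) = 0` (derived here).
[cite: Hironaka1970AdditiveGroups, additive forms and differential operators] -/
theorem pderiv_lineSubst_eq_zero (k₀ : σ) {v : σ → K} (B : Finset σ) (hv : ∀ k ∉ B, v k = 0)
    {F : MvPolynomial σ K} (hker : (∑ k ∈ B, v k • pderiv k F) = 0) :
    pderiv k₀ (lineSubst k₀ v F) = 0 := by
  rw [pderiv_lineSubst k₀ B hv, hker, map_zero]

/-! ## The substitution is an automorphism when `v_{k₀} ≠ 0` -/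

/-- Generator images of the inverse substitution: `X_{k₀} ↦ v_{k₀}⁻¹ X_{k₀}`,
`X_j ↦ X_j - v_j v_{k₀}⁻¹ X_{k₀}`. [cite: AbramovichTemkinWlodarczyk2024, §5.2 (p. 1576)] -/
noncomputable def lineGenInv (k₀ : σ) (v : σ → K) (j : σ) : MvPolynomial σ K :=
  if j = k₀ then C (v k₀)⁻¹ * X k₀ else X j - C (v j * (v k₀)⁻¹) * X k₀

/-- The inverse substitution. [cite: AbramovichTemkinWlodarczyk2024, §5.2 (p. 1576)] -/
noncomputable def lineSubstInv (k₀ : σ) (v : σ → K) : MvPolynomial σ K →ₐ[K] MvPolynomial σ K :=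
  aeval (lineGenInv k₀ v)

/-- `lineSubst ∘ lineSubstInv = id` for `v_{k₀} ≠ 0` (derived here).
[cite: AbramovichTemkinWlodarczyk2024, §5.2 (p. 1576)] -/
theorem lineSubst_comp_lineSubstInv (k₀ : σ) {v : σ → K} (hv : v k₀ ≠ 0) :
    (lineSubst k₀ v).comp (lineSubstInv k₀ v) = AlgHom.id K (MvPolynomial σ K) := by
  apply MvPolynomial.algHom_ext
  intro j
  rw [AlgHom.comp_apply, AlgHom.id_apply, lineSubstInv, aeval_X, lineGenInv]
  split_ifs with h
  · subst h
    rw [map_mul, algHom_C, MvPolynomial.algebraMap_eq, lineSubst_X, lineGen, if_pos rfl,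
      ← mul_assoc, ← C_mul, inv_mul_cancel₀ hv, C_1, one_mul]
  · rw [map_sub, map_mul, algHom_C, MvPolynomial.algebraMap_eq, lineSubst_X, lineSubst_X, lineGen,
      lineGen, if_neg h, if_pos rfl, ← mul_assoc, ← C_mul,
      show v j * (v k₀)⁻¹ * v k₀ = v j by rw [mul_assoc, inv_mul_cancel₀ hv, mul_one]]
    ring

/-- `lineSubstInv ∘ lineSubst = id` for `v_{k₀} ≠ 0` (derived here).
[cite: AbramovichTemkinWlodarczyk2024, §5.2 (p. 1576)] -/
theorem lineSubstInv_comp_lineSubst (k₀ : σ) {v : σ → K} (hv : v k₀ ≠ 0) :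
    (lineSubstInv k₀ v).comp (lineSubst k₀ v) = AlgHom.id K (MvPolynomial σ K) := by
  apply MvPolynomial.algHom_ext
  intro j
  rw [AlgHom.comp_apply, AlgHom.id_apply, lineSubst_X, lineGen]
  have hX : lineSubstInv k₀ v (X k₀) = C (v k₀)⁻¹ * X k₀ := by
    rw [lineSubstInv, aeval_X, lineGenInv, if_pos rfl]
  split_ifs with h
  · subst h
    rw [map_mul, algHom_C, MvPolynomial.algebraMap_eq, hX, ← mul_assoc, ← C_mul,
      mul_inv_cancel₀ hv, C_1, one_mul]
  · rw [map_add, map_mul, algHom_C, MvPolynomial.algebraMap_eq, hX, lineSubstInv, aeval_X,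
      lineGenInv, if_neg h, C_mul, ← mul_assoc, sub_add_cancel]

/-- Hence `lineSubst k₀ v` is bijective for `v_{k₀} ≠ 0` (derived here).
[cite: AbramovichTemkinWlodarczyk2024, §5.2 (p. 1576)] -/
theorem lineSubst_bijective (k₀ : σ) {v : σ → K} (hv : v k₀ ≠ 0) :
    Function.Bijective (lineSubst k₀ v) := by
  refine Function.bijective_iff_has_inverse.mpr ⟨lineSubstInv k₀ v, fun P => ?_, fun P => ?_⟩
  · have h := congrArg (fun φ => φ P) (lineSubstInv_comp_lineSubst k₀ hv)
    simpa using h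
  · have h := congrArg (fun φ => φ P) (lineSubst_comp_lineSubstInv k₀ hv)
    simpa using h

/-! ## Weighted homogeneity within one block -/

/-- If every `j` with `v_j ≠ 0` has the weight of `k₀` (the direction lies in one block), the
substitution preserves `w`-homogeneity (derived here).
[cite: AbramovichTemkinWlodarczyk2024, §5.2 (pp. 1576–1577)] -/
theorem isWeightedHomogeneous_lineSubst (k₀ : σ) {v : σ → K} (w : σ → ℕ)
    (hw : ∀ j, v j ≠ 0 → w j = w k₀) {F : MvPolynomial σ K} {n : ℕ}
    (hF : IsWeightedHomogeneous w F n) : IsWeightedHomogeneous w (lineSubst k₀ v F) n := by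
  unfold lineSubst
  refine isWeightedHomogeneous_aeval w (lineGen k₀ v) (fun j => ?_) hF
  unfold lineGen
  split_ifs with h
  · subst h
    have h1 := (isWeightedHomogeneous_C w (v j)).mul (isWeightedHomogeneous_X K w j)
    rwa [zero_add] at h1
  · by_cases hvj : v j = 0
    · rw [hvj, C_0, zero_mul, add_zero]
      exact isWeightedHomogeneous_X K w j
    · have h1 := (isWeightedHomogeneous_C w (v j)).mul (isWeightedHomogeneous_X K w k₀)
      rw [zero_add, ← hw j hvj] at h1
      exact (isWeightedHomogeneous_X K w j).add h1

/-! ## A worked instance -/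

section Instance

/-- `F = (X₀ - X₁)²` on `Fin 2`, direction `v = (1, 1)` (a kernel vector: `∂₀F + ∂₁F = 0`); the
substitution `X₀ ↦ X₀`, `X₁ ↦ X₁ + X₀` turns `F` into `X₁²`, and `∂₀ (F ∘ A) = 0` as the chain
rule predicts. [folklore] -/
example : lineSubst (0 : Fin 2) (fun _ => (1 : K)) ((X 0 - X 1) ^ 2) = X 1 ^ 2 := by
  simp [lineSubst, lineGen]

/-- [folklore] the chain-rule exit on the instance. -/
example : pderiv 0 (lineSubst (0 : Fin 2) (fun _ => (1 : K)) ((X 0 - X 1) ^ 2)) = 0 := by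
  apply pderiv_lineSubst_eq_zero 0 (Finset.univ : Finset (Fin 2))
    (fun k hk => absurd (Finset.mem_univ k) hk)
  simp only [Fin.sum_univ_two, one_smul, sq, pderiv_mul, map_sub, pderiv_X_self,
    pderiv_X_of_ne (show (1 : Fin 2) ≠ 0 by decide),
    pderiv_X_of_ne (show (0 : Fin 2) ≠ 1 by decide)]
  ring

end Instance

end Literature.AlgebraicGeometry.Resolution.WeightedBlowup
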